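import Literature.Probability.RandomPlanarGeometry.HexSAWStripWidthTwoContactRecursion
import Literature.Analysis.Asymptotics.SequenceConvolutionAsymptotics
import Literature.Analysis.Calculus.InversePowerSeries
import HarnessLib

/-!
# The width-two strip at criticality: the contact hat sums grow linearly with EXPLICIT slope and intercept
# (module «WIDTH-TWO CONTACT ASYMPTOTICS»)

Topic `Literature/Probability/RandomPlanarGeometry` (continues «WIDTH-TWO CONTACT RECURSION» (`W2.hatCD_two_eq_sum`, `W2.kOneTwo`), «WIDTH-TWO HAT CONVERGENCE»
(`W2.projTwo`, `W2.nilTwo`, `W2.limTwo`, `W2.gTwo_pow_succ_eq`, `W2.nilTwo_cubic`, `W2.rTwo`, `W2.rTwo_lt_one`) and the lane tool «CONVOLUTION ASYMPTOTICS»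
(`Literature.Analysis.cauchyProdCoeff`, `tendsto_cauchyProdCoeff_sub_linear`)).  Lane «pcv-sawmu» (CriticalPhenomena venture), a-p2 g26 — CAR V-C part 2a of
`HOME/pub-sawmu-a-p2/g26/DESIGN-VARIANCE-RATE-T2.md` §5 (steps (1)–(3)).  Setting: W. Feller I (1968) XIII.6 (moments of the number of renewals: E N_k = k/μ +
const + o(1) by the renewal argument); R. P. Stanley, EC1 (2012) §4.1 (rational generating functions).  Nothing below is printed.

## What is proved (namespace `…SAW.HV.W2`, at `y = y₂ = stripYT 2` unless stated; `x = x_c`, `Π = projTwo`, `N = nilTwo`, `P = 1 + M̂(0)`)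

§1 Geometric tools: the tree's `Literature.Analysis.Calculus.InversePowerSeries.succ_mul_pow_le` (`(n+1)Kⁿ ≤ K'/(K'−K)·K'ⁿ`, reused, not restated); `rhoTwo := (1 + rTwo)/2` with
`rTwo_lt_rhoTwo`, `rhoTwo_lt_one`; `nil_seq_rec_mul` (the order-two recurrence of `n ↦ (N^{n+1}·X)_{ab}` for ANY right factor `X`), `nilTwo_pow_mul_abs_le`
(a-p5's deflation bound), ★ `exists_nilTwo_pow_mul_abs_le` (`∃ C, ∀ n, |(N^{n+1}X)_{ab}| ≤ C·ρⁿ`), ★★ `exists_gTwo_pow_mul_sub_abs_le`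
(`∃ C, ∀ i, |(G^i X)_{ab} − (Π X)_{ab}| ≤ C·ρ^i` — every entry of `G^i·X` converges geometrically to `Π·X`).
§2 ★ `hatCD_two_succ_apply_eq` (any `y > 0`): `Ĉ_D(k+1)_{ab} = x y · cauchyProdCoeff (j ↦ (G^j P)_{3b}) (i ↦ (G^i)_{a2}) k + x² y · cauchyProdCoeff (j ↦ (G^j P)_{3b}) (i ↦ (G^i)_{a3}) k`
(`K₁` has the two nonzero entries `(2,3) = xy`, `(3,3) = x²y`).
§3 ★★★ **`tendsto_hatCD_two_sub_linear (a b)`**: `Ĉ_D(k+1)_{ab} − slopeCTwo a b · (k+1) → interceptCTwo a b` with the EXPLICIT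
`slopeCTwo a b = limTwo 3 b · (x y₂ Π_{a2} + x² y₂ Π_{a3})` and `interceptCTwo a b` = the corresponding combination of the two deviation series
`Σ'_j ((G^j P)_{3b} − limTwo_{3b})`, `Σ'_i ((G^i)_{ac} − Π_{ac})` (convergent by §1).

Label: LANE THEOREM (own result of lane «pcv-sawmu», a-p2 g26, 2026-08-27; not in print).  NOT claimed: closed forms of the two deviation series over `ℚ(x)`,
the squared-contact asymptotics and the variance rate (DESIGN §5 steps (3′)–(6), heir).
-/

noncomputable section

open Finset Filter Topology Matrix Literature.Probability.LatticeModels Literature.Probability.Percolation Literature.Analysis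

namespace Literature.Probability.RandomPlanarGeometry.SAW

namespace HV

namespace W2

/-! ## §1 Geometric tools -/

/-- The working geometric ratio `ρ = (1 + rTwo)/2` (`rTwo = 0.2766 < ρ = 0.638 < 1`). [cite: Feller1968, XIII.10; lane plumbing] -/
def rhoTwo : ℝ := (1 + rTwo) / 2

/-- `0 ≤ rTwo < rhoTwo < 1`. [cite: Feller1968, XIII.10; lane plumbing] -/
theorem rhoTwo_facts : 0 ≤ rTwo ∧ rTwo < rhoTwo ∧ rhoTwo < 1 ∧ 0 < rhoTwo := by
  have h0 : 0 ≤ rTwo := Literature.Analysis.quadRootBound_nonneg _ _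
  have h1 := rTwo_lt_one
  refine ⟨h0, ?_, ?_, ?_⟩ <;> rw [rhoTwo] <;> linarith

/-- The order-two recurrence of the nilpotent-part sequences `n ↦ (N^{n+1}·X)_{ab}` for ANY right factor `X` (from `N³ + pN² + κN = 0`).
[cite: Stanley2012EC1, §4.1 Theorem 4.1.1; lane plumbing] -/
theorem nil_seq_rec_mul (X : Matrix (Fin (2 * 2)) (Fin (2 * 2)) ℝ) (a b : Fin (2 * 2)) (n : ℕ) :
    (nilTwo ^ (n + 2 + 1) * X) a b = -pTwo * (nilTwo ^ (n + 1 + 1) * X) a b - kTwo * (nilTwo ^ (n + 1) * X) a b := by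
  have hc := nilTwo_cubic
  have hmat : (nilTwo ^ (n + 2 + 1) + pTwo • nilTwo ^ (n + 1 + 1) + kTwo • nilTwo ^ (n + 1)) * X = 0 := by
    rw [show nilTwo ^ (n + 2 + 1) = nilTwo ^ n * nilTwo ^ 3 by rw [← pow_add],
      show nilTwo ^ (n + 1 + 1) = nilTwo ^ n * nilTwo ^ 2 by rw [← pow_add],
      show nilTwo ^ (n + 1) = nilTwo ^ n * nilTwo by rw [pow_succ],
      ← Matrix.mul_smul, ← Matrix.mul_smul, ← Matrix.mul_add, ← Matrix.mul_add, hc, Matrix.mul_zero, Matrix.zero_mul]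
  have h := congrFun (congrFun hmat a) b
  simp only [Matrix.add_mul, Matrix.smul_mul, Matrix.add_apply, Matrix.smul_apply, Matrix.zero_apply, smul_eq_mul] at h
  linarith

/-- a-p5's deflation bound for the sequences `(N^{n+1}·X)_{ab}`: `|(N^{n+2}X)_{ab}| ≤ r^{n+1}|c₀| + (n+1)rⁿ(|c₁| + r|c₀|)`, `c₀ = (NX)_{ab}`, `c₁ = (N²X)_{ab}`.
[cite: Stanley2012EC1, §4.1 Theorem 4.1.1 (iii); lane plumbing] -/
theorem nilTwo_pow_mul_abs_le (X : Matrix (Fin (2 * 2)) (Fin (2 * 2)) ℝ) (a b : Fin (2 * 2)) (n : ℕ) :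
    |(nilTwo ^ (n + 2) * X) a b| ≤
      rTwo ^ (n + 1) * |(nilTwo * X) a b| + ((n : ℝ) + 1) * rTwo ^ n * (|(nilTwo ^ 2 * X) a b| + rTwo * |(nilTwo * X) a b|) := by
  set w : ℕ → ℝ := fun m => (nilTwo ^ (m + 1) * X) a b with hw
  have hrec : ∀ m, w (m + 2) = -pTwo * w (m + 1) - kTwo * w m := fun m => nil_seq_rec_mul X a b m
  have hR0 : 0 ≤ rTwo := Literature.Analysis.quadRootBound_nonneg _ _
  have hR : ∀ σ : ℂ, σ ^ 2 + (pTwo : ℂ) * σ + (kTwo : ℂ) = 0 → ‖σ‖ ≤ rTwo := fun σ hσ => Literature.Analysis.norm_le_quadRootBound hσ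
  have h := Literature.Analysis.abs_le_of_rec_two hR0 hR hrec n
  have e0 : w 0 = (nilTwo * X) a b := by simp [hw]
  have e1 : w 1 = (nilTwo ^ 2 * X) a b := by simp [hw]
  have e2 : w (n + 1) = (nilTwo ^ (n + 2) * X) a b := by simp [hw]
  rw [e0, e1, e2] at h
  exact h

/-- ★ **Every entry of `N^{n+1}·X` is geometrically small**: `∃ C ≥ 0, ∀ n, |(N^{n+1}X)_{ab}| ≤ C·ρⁿ` (`ρ = rhoTwo`).
[cite: Feller1968, XIII.10 (geometric rate); Stanley2012EC1, §4.1; lane «pcv-sawmu» a-p2 g26] -/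
theorem exists_nilTwo_pow_mul_abs_le (X : Matrix (Fin (2 * 2)) (Fin (2 * 2)) ℝ) (a b : Fin (2 * 2)) :
    ∃ C : ℝ, 0 ≤ C ∧ ∀ n : ℕ, |(nilTwo ^ (n + 1) * X) a b| ≤ C * rhoTwo ^ n := by
  obtain ⟨hr0, hrρ, hρ1, hρ0⟩ := rhoTwo_facts
  set c₀ := |(nilTwo * X) a b| with hc₀
  set c₁ := |(nilTwo ^ 2 * X) a b| with hc₁
  have hc₀0 : 0 ≤ c₀ := abs_nonneg _
  have hc₁0 : 0 ≤ c₁ := abs_nonneg _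
  -- constant: covers n = 0 (value c₀) and n = m + 1 via the deflation bound with (m+1) r^m ≤ ρ/(ρ−r) ρ^m
  refine ⟨c₀ + (c₀ + rhoTwo / (rhoTwo - rTwo) * (c₁ + rTwo * c₀)) / rhoTwo, by positivity, fun n => ?_⟩
  have hK0 : 0 ≤ rhoTwo / (rhoTwo - rTwo) * (c₁ + rTwo * c₀) := by
    have : 0 < rhoTwo - rTwo := by linarith
    positivity
  rcases n with _ | m
  · rw [pow_zero, mul_one, zero_add, pow_one, ← hc₀]
    have : 0 ≤ (c₀ + rhoTwo / (rhoTwo - rTwo) * (c₁ + rTwo * c₀)) / rhoTwo := by positivity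
    linarith
  · have h := nilTwo_pow_mul_abs_le X a b m
    rw [← hc₀, ← hc₁, show m + 2 = m + 1 + 1 from rfl] at h
    have hρm : 0 ≤ rhoTwo ^ m := pow_nonneg hρ0.le m
    -- r^(m+1) c₀ ≤ ρ^m c₀
    have h1 : rTwo ^ (m + 1) * c₀ ≤ rhoTwo ^ m * c₀ := by
      apply mul_le_mul_of_nonneg_right _ hc₀0
      calc rTwo ^ (m + 1) ≤ rTwo ^ m := pow_le_pow_of_le_one hr0 (by linarith) (by omega)
        _ ≤ rhoTwo ^ m := pow_le_pow_left₀ hr0 hrρ.le m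
    -- (m+1) r^m K ≤ ρ/(ρ−r) ρ^m K
    have h2 : ((m : ℝ) + 1) * rTwo ^ m * (c₁ + rTwo * c₀) ≤ rhoTwo / (rhoTwo - rTwo) * rhoTwo ^ m * (c₁ + rTwo * c₀) :=
      mul_le_mul_of_nonneg_right (Literature.Analysis.Calculus.succ_mul_pow_le hr0 hrρ m) (by positivity)
    have h3 : |(nilTwo ^ (m + 1 + 1) * X) a b| ≤ (c₀ + rhoTwo / (rhoTwo - rTwo) * (c₁ + rTwo * c₀)) * rhoTwo ^ m := by
      calc |(nilTwo ^ (m + 1 + 1) * X) a b| ≤ rTwo ^ (m + 1) * c₀ + ((m : ℝ) + 1) * rTwo ^ m * (c₁ + rTwo * c₀) := h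
        _ ≤ rhoTwo ^ m * c₀ + rhoTwo / (rhoTwo - rTwo) * rhoTwo ^ m * (c₁ + rTwo * c₀) := add_le_add h1 h2
        _ = (c₀ + rhoTwo / (rhoTwo - rTwo) * (c₁ + rTwo * c₀)) * rhoTwo ^ m := by ring
    calc |(nilTwo ^ (m + 1 + 1) * X) a b| ≤ (c₀ + rhoTwo / (rhoTwo - rTwo) * (c₁ + rTwo * c₀)) * rhoTwo ^ m := h3
      _ = (c₀ + rhoTwo / (rhoTwo - rTwo) * (c₁ + rTwo * c₀)) / rhoTwo * rhoTwo ^ (m + 1) := by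
          rw [pow_succ]; field_simp
      _ ≤ (c₀ + (c₀ + rhoTwo / (rhoTwo - rTwo) * (c₁ + rTwo * c₀)) / rhoTwo) * rhoTwo ^ (m + 1) := by
          apply mul_le_mul_of_nonneg_right _ (pow_nonneg hρ0.le _)
          linarith

/-- ★★ **Every entry of `G^i·X` converges geometrically to `Π·X`** (at `y₂`): `∃ C, ∀ i, |(G^i X)_{ab} − (Π X)_{ab}| ≤ C·ρ^i` — `G^{m+1} = Π + N^{m+1}`
(«WIDTH-TWO HAT CONVERGENCE» `gTwo_pow_succ_eq`) and §1's bound; `i = 0` is absorbed in the constant.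
[cite: Feller1968, XIII.10; Stanley2012EC1, §4.1 Theorem 4.1.1; lane «pcv-sawmu» a-p2 g26 — own] -/
theorem exists_gTwo_pow_mul_sub_abs_le (X : Matrix (Fin (2 * 2)) (Fin (2 * 2)) ℝ) (a b : Fin (2 * 2)) :
    ∃ C : ℝ, ∀ i : ℕ, |(gTwo (stripYT 2) ^ i * X) a b - (projTwo * X) a b| ≤ C * rhoTwo ^ i := by
  obtain ⟨hr0, hrρ, hρ1, hρ0⟩ := rhoTwo_facts
  obtain ⟨C, hC0, hC⟩ := exists_nilTwo_pow_mul_abs_le X a b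
  refine ⟨max (|X a b - (projTwo * X) a b|) (C / rhoTwo), fun i => ?_⟩
  rcases i with _ | m
  · rw [pow_zero, Matrix.one_mul, pow_zero, mul_one]
    exact le_max_left _ _
  · rw [gTwo_pow_succ_eq, Matrix.add_mul, Matrix.add_apply, add_sub_cancel_left]
    calc |(nilTwo ^ (m + 1) * X) a b| ≤ C * rhoTwo ^ m := hC m
      _ = C / rhoTwo * rhoTwo ^ (m + 1) := by rw [pow_succ]; field_simp
      _ ≤ max (|X a b - (projTwo * X) a b|) (C / rhoTwo) * rhoTwo ^ (m + 1) :=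
          mul_le_mul_of_nonneg_right (le_max_right _ _) (pow_nonneg hρ0.le _)

/-! ## §2 The contact sums as Cauchy products -/

/-- Row `c` of `K₁` is supported on column `3`: `(K₁·Y)_{cb} = (K₁)_{c3}·Y_{3b}`. [cite: Feller1968, XIII.6; lane plumbing] -/
theorem kOneTwo_mul_apply (y : ℝ) (Y : Matrix (Fin (2 * 2)) (Fin (2 * 2)) ℝ) (c b : Fin (2 * 2)) :
    (kOneTwo y * Y) c b = kOneTwo y c 3 * Y 3 b := by
  rw [Matrix.mul_apply, Fin.sum_univ_four]
  fin_cases c <;> simp [kOneTwo]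

/-- `(Z·K₁·Y)_{ab} = x y · Z_{a2} Y_{3b} + x² y · Z_{a3} Y_{3b}` (the two nonzero entries of `K₁`). [cite: Feller1968, XIII.6; lane plumbing] -/
theorem mul_kOneTwo_mul_apply (y : ℝ) (Z Y : Matrix (Fin (2 * 2)) (Fin (2 * 2)) ℝ) (a b : Fin (2 * 2)) :
    (Z * kOneTwo y * Y) a b = hexCriticalFugacity * y * (Z a 2 * Y 3 b) + hexCriticalFugacity ^ 2 * y * (Z a 3 * Y 3 b) := by
  rw [Matrix.mul_assoc, Matrix.mul_apply, Fin.sum_univ_four, kOneTwo_mul_apply, kOneTwo_mul_apply, kOneTwo_mul_apply, kOneTwo_mul_apply]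
  simp [kOneTwo]
  ring

/-- ★ **The contact hat sums of `S₂` are two Cauchy products** (any `y > 0`):
`Ĉ_D(k+1)_{ab} = x y · Σ_{j≤k} (G^j P)_{3b} (G^{k−j})_{a2} + x² y · Σ_{j≤k} (G^j P)_{3b} (G^{k−j})_{a3}`, `P = 1 + M̂(0)`.
[cite: Feller1968, XIII.6 (renewal argument for the first moment); lane «pcv-sawmu» a-p2 g26 — own] -/
theorem hatCD_two_succ_apply_eq {y : ℝ} (hy : 0 < y) (k : ℕ) (a b : Fin (2 * 2)) :
    hatCD y (k + 1) a b =
      hexCriticalFugacity * y * cauchyProdCoeff (fun j => (gTwo y ^ j * (1 + hatMZeroTwo)) 3 b) (fun i => (gTwo y ^ i) a 2) k +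
        hexCriticalFugacity ^ 2 * y * cauchyProdCoeff (fun j => (gTwo y ^ j * (1 + hatMZeroTwo)) 3 b) (fun i => (gTwo y ^ i) a 3) k := by
  rw [hatCD_two_eq_sum hy, Matrix.sum_apply, cauchyProdCoeff, cauchyProdCoeff, Finset.mul_sum, Finset.mul_sum, ← Finset.sum_add_distrib]
  refine Finset.sum_congr rfl fun j _ => ?_
  rw [Matrix.mul_assoc (gTwo y ^ (k - j) * kOneTwo y), mul_kOneTwo_mul_apply]
  ring


/-! ## §3 Linear asymptotics of the contact sums at criticality -/

/-- The deviation series of the powers of `G`: `Σ'_i ((G^i)_{ac} − Π_{ac})` (absolutely convergent by §1). [cite: Feller1968, XIII.6; lane «pcv-sawmu» a-p2 g26] -/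
def devGSumTwo (a c : Fin (2 * 2)) : ℝ := ∑' i : ℕ, ((gTwo (stripYT 2) ^ i) a c - projTwo a c)

/-- The deviation series of the hat bridge sums: `Σ'_j ((G^j P)_{3b} − limTwo_{3b})`, `P = 1 + M̂(0)` (so the `j`-th term is `D̂(j)_{3b} − A_{3b}` for `j ≥ 1`).
[cite: Feller1968, XIII.6; lane «pcv-sawmu» a-p2 g26] -/
def devDSumTwo (b : Fin (2 * 2)) : ℝ := ∑' j : ℕ, ((gTwo (stripYT 2) ^ j * (1 + hatMZeroTwo)) 3 b - limTwo 3 b)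

/-- ★ The SLOPE of the contact hat sums: `𝔄_{ab} = limTwo_{3b}·(x y₂ Π_{a2} + x² y₂ Π_{a3})` (`= (Π·K₁·limTwo)_{ab}`).
[cite: Feller1968, XIII.6 (E N_k ∼ k/μ); lane «pcv-sawmu» a-p2 g26] -/
def slopeCTwo (a b : Fin (2 * 2)) : ℝ :=
  limTwo 3 b * (hexCriticalFugacity * stripYT 2 * projTwo a 2 + hexCriticalFugacity ^ 2 * stripYT 2 * projTwo a 3)

/-- ★ The INTERCEPT of the contact hat sums (explicit in the two deviation series). [cite: Feller1968, XIII.6 (the constant term of E N_k); lane «pcv-sawmu» a-p2 g26] -/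
def interceptCTwo (a b : Fin (2 * 2)) : ℝ :=
  hexCriticalFugacity * stripYT 2 * (limTwo 3 b * devGSumTwo a 2 + projTwo a 2 * devDSumTwo b) +
    hexCriticalFugacity ^ 2 * stripYT 2 * (limTwo 3 b * devGSumTwo a 3 + projTwo a 3 * devDSumTwo b)

/-- ★★★ **LINEAR ASYMPTOTICS OF THE CONTACT HAT SUMS OF `S₂` AT CRITICALITY**: for all levels `a, b`,
`Ĉ_D(k+1)_{ab} − slopeCTwo a b · (k+1) → interceptCTwo a b` — the contact-weighted bridge sums grow linearly in the hat index with explicit slope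
and an intercept given by two geometrically convergent deviation series (§2's Cauchy products + «CONVOLUTION ASYMPTOTICS» + §1's geometric bounds).
Dividing by `D̂(k+1)_{ab} → limTwo_{ab}` («WIDTH-TWO HAT CONVERGENCE») this is the mean number of surface contacts `= (slope/limTwo_{ab})·k + O(1)`.
[cite: Feller1968, XIII.6 (renewal argument for E N_k); DuminilCopinHammond2013, §2.2; lane «pcv-sawmu» a-p2 g26 — own result, not in print] -/
theorem tendsto_hatCD_two_sub_linear (a b : Fin (2 * 2)) :
    Tendsto (fun k : ℕ => hatCD (stripYT 2) (k + 1) a b - slopeCTwo a b * ((k : ℝ) + 1)) atTop (𝓝 (interceptCTwo a b)) := by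
  obtain ⟨hr0, hrρ, hρ1, hρ0⟩ := rhoTwo_facts
  have hy : 0 < stripYT 2 := stripYT_pos (by norm_num)
  obtain ⟨Ca, ha⟩ := exists_gTwo_pow_mul_sub_abs_le (1 + hatMZeroTwo) 3 b
  simp only [projTwo_mul_one_add] at ha
  obtain ⟨C2, h2⟩ := exists_gTwo_pow_mul_sub_abs_le 1 a 2
  obtain ⟨C3, h3⟩ := exists_gTwo_pow_mul_sub_abs_le 1 a 3
  simp only [Matrix.mul_one] at h2 h3
  have t2 := tendsto_cauchyProdCoeff_sub_linear (a := fun j => (gTwo (stripYT 2) ^ j * (1 + hatMZeroTwo)) 3 b)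
    (b := fun i => (gTwo (stripYT 2) ^ i) a 2) hρ0.le hρ1 ha h2
  have t3 := tendsto_cauchyProdCoeff_sub_linear (a := fun j => (gTwo (stripYT 2) ^ j * (1 + hatMZeroTwo)) 3 b)
    (b := fun i => (gTwo (stripYT 2) ^ i) a 3) hρ0.le hρ1 ha h3
  have t := (t2.const_mul (hexCriticalFugacity * stripYT 2)).add (t3.const_mul (hexCriticalFugacity ^ 2 * stripYT 2))
  refine (t.congr fun k => ?_).trans (by rw [interceptCTwo, devGSumTwo, devGSumTwo, devDSumTwo])
  rw [hatCD_two_succ_apply_eq hy, slopeCTwo]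
  ring


end W2

end HV

end Literature.Probability.RandomPlanarGeometry.SAW
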